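import Summits.AtomisticToContinuum.HydrodynamicLimit.Theses.LambertianContactSwap
import Summits.AtomisticToContinuum.HydrodynamicLimit.Theorems.LambertianContactSwapSwapGapEntropyTransfer
import Summits.AtomisticToContinuum.HydrodynamicLimit.Theorems.LambertianContactSwapSwapGapFieldConcentrationOfLD
import Literature.MathematicalPhysics.KineticTheory.LambertianHardSphereFlow
import HarnessLib

/-!
# `SwapGap` (stmt-AtomisticToContinuum-11850), line `Sketch`, glue stub G1: `LambertianEuler → FieldConcentration → LambertianEulerLD`

Helper file (`--supports stmt-AtomisticToContinuum-11850`) of line `Sketch` (card `entropy-relative-to-lambertian-law`) for the crux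
`Summit.AtomisticToContinuum.HydrodynamicLimit.Theses.LambertianContactSwap.SwapGap`, registered stub
`stub_LD_of_euler_of_fieldConcentration` of the lead's skeleton v6: convergence in probability of the Lambertian gas's `χ`-tested
fields to the Euler values (the sibling crux `LambertianEuler`, stmt-AtomisticToContinuum-11854, in its named form) upgrades to
the exponential rate `C e^{-(N+1)/C}` (v5's `stub_lambertianEulerLD`) as soon as every bounded 1-Lipschitz field statistic
self-averages at speed `N` (stub S2).  Converse of the landed `fieldConcentration_of_lambertianEulerLD` (p106600) modulo 11854.

prover-line-stmt-AtomisticToContinuum-11850-c3-0 (wave 4 worker), cycle 4.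
-/

noncomputable section

open MeasureTheory Filter Set Topology InformationTheory
open scoped ENNReal

namespace Summit.AtomisticToContinuum.HydrodynamicLimit.Theorems

open Literature.Analysis.FluidPDE Literature.MathematicalPhysics.KineticTheory
open Summit.AtomisticToContinuum.HydrodynamicLimit.Theses.LambertianContactSwap

/-! ### Plumbing: the three test statistics -/

/-- `y ↦ min 1 |y.1 − a|` is `1`-Lipschitz on `ℝ × V3 × ℝ` (sup distance). [folklore] -/
private theorem lipschitzWith_min_one_abs_fst_sub (a : ℝ) :
    LipschitzWith 1 fun y : ℝ × V3 × ℝ => min 1 |y.1 - a| := by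
  refine LipschitzWith.const_min (LipschitzWith.mk_one fun y y' => ?_) 1
  rw [Real.dist_eq, Prod.dist_eq, Real.dist_eq]
  calc abs (|y.1 - a| - |y'.1 - a|) ≤ |(y.1 - a) - (y'.1 - a)| := abs_abs_sub_abs_le_abs_sub _ _
    _ = |y.1 - y'.1| := by rw [sub_sub_sub_cancel_right]
    _ ≤ max |y.1 - y'.1| (dist y.2 y'.2) := le_max_left _ _

/-- `y ↦ min 1 ‖y.2.1 − b‖` is `1`-Lipschitz on `ℝ × V3 × ℝ` (sup distance). [folklore] -/
private theorem lipschitzWith_min_one_norm_snd_fst_sub (b : V3) :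
    LipschitzWith 1 fun y : ℝ × V3 × ℝ => min 1 ‖y.2.1 - b‖ := by
  refine LipschitzWith.const_min (LipschitzWith.mk_one fun y y' => ?_) 1
  rw [Real.dist_eq, Prod.dist_eq, Prod.dist_eq (x := y.2), dist_eq_norm y.2.1]
  calc |‖y.2.1 - b‖ - ‖y'.2.1 - b‖| ≤ ‖(y.2.1 - b) - (y'.2.1 - b)‖ := abs_norm_sub_norm_le _ _
    _ = ‖y.2.1 - y'.2.1‖ := by rw [sub_sub_sub_cancel_right]
    _ ≤ max (dist y.1 y'.1) (max ‖y.2.1 - y'.2.1‖ (dist y.2.2 y'.2.2)) :=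
        (le_max_left _ _).trans (le_max_right _ _)

/-- `y ↦ min 1 |y.2.2 − a|` is `1`-Lipschitz on `ℝ × V3 × ℝ` (sup distance). [folklore] -/
private theorem lipschitzWith_min_one_abs_snd_snd_sub (a : ℝ) :
    LipschitzWith 1 fun y : ℝ × V3 × ℝ => min 1 |y.2.2 - a| := by
  refine LipschitzWith.const_min (LipschitzWith.mk_one fun y y' => ?_) 1
  rw [Real.dist_eq, Prod.dist_eq, Prod.dist_eq (x := y.2), Real.dist_eq (x := y.2.2)]
  calc abs (|y.2.2 - a| - |y'.2.2 - a|) ≤ |(y.2.2 - a) - (y'.2.2 - a)| :=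
      abs_abs_sub_abs_le_abs_sub _ _
    _ = |y.2.2 - y'.2.2| := by rw [sub_sub_sub_cancel_right]
    _ ≤ max (dist y.1 y'.1) (max (dist y.2.1 y'.2.1) |y.2.2 - y'.2.2|) :=
        (le_max_right _ _).trans (le_max_right _ _)

/-- `|min 1 r| ≤ 1` for `r ≥ 0`. [folklore] -/
private theorem abs_min_one_le_one {r : ℝ} (hr : 0 ≤ r) : |min 1 r| ≤ 1 := by
  rw [abs_of_nonneg (le_min zero_le_one hr)]
  exact min_le_left _ _

/-! ### Abstract bookkeeping: convergence in probability plus self-averaging of the truncation -/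

/-- **Convergence in probability to zero plus exponential self-averaging of the truncation gives
exponential smallness.** On probability spaces `(Ω_N, μ_N)`, let `D_N ≥ 0` be measurable with
`μ_N{η < D_N} → 0` for every `η > 0` and suppose that the truncation `G_N := min 1 D_N ∈ [0, 1]`
concentrates exponentially around its mean: for every `δ' > 0` some `C > 0` has
`μ_N{δ' < |G_N − ∫ G_N dμ_N|} ≤ C e^{-(N+1)/C}` for all `N`. Then for every `δ > 0` some `C > 0` has
`μ_N{δ < D_N} ≤ C e^{-(N+1)/C}` for all `N`. Proof: `{η < |G_N|} ⊆ {η < D_N}`, so `∫ G_N dμ_N → 0`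
(`tendsto_integral_sub_of_tendsto_measure`); with `δ₁ := min δ 2⁻¹`, for `N ≥ N₀` one has
`∫ G_N ≤ δ₁/2` and `{δ < D_N} ⊆ {δ₁ < G_N} ⊆ {δ₁/2 < |G_N − ∫ G_N|}`; the finitely many `N < N₀` are
absorbed into the constant `max C (max N₀ 3)` (`UniformLGC.Kexp_le_Kexp`, as in
`expConc_sub_integral_of_expConc_sub_const`). [folklore] -/
private theorem expConc_of_tendsto_measure_of_expConc_min {Ω : ℕ → Type*}
    [∀ N, MeasurableSpace (Ω N)] (μ : (N : ℕ) → Measure (Ω N))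
    (hμ : ∀ N, IsProbabilityMeasure (μ N))
    (D : (N : ℕ) → Ω N → ℝ) (hD : ∀ N, Measurable (D N)) (hD0 : ∀ N x, 0 ≤ D N x)
    (hL : ∀ η : ℝ, 0 < η → Tendsto (fun N => μ N {x | η < D N x}) atTop (𝓝 0))
    (h2 : ∀ δ' : ℝ, 0 < δ' → ∃ C : ℝ, 0 < C ∧ ∀ N : ℕ,
      μ N {x | δ' < |min 1 (D N x) - ∫ y, min 1 (D N y) ∂μ N|} ≤
        ENNReal.ofReal (C * Real.exp (-(C⁻¹ * ((N : ℝ) + 1)))))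
    {δ : ℝ} (hδ : 0 < δ) :
    ∃ C : ℝ, 0 < C ∧ ∀ N : ℕ, μ N {x | δ < D N x} ≤
      ENNReal.ofReal (C * Real.exp (-(C⁻¹ * ((N : ℝ) + 1)))) := by
  -- the means of the truncations `min 1 D_N ∈ [0, 1]` tend to zero
  have hm : Tendsto (fun N => ∫ y, min 1 (D N y) ∂μ N) atTop (𝓝 0) := by
    have h := tendsto_integral_sub_of_tendsto_measure μ hμ (fun N y => min 1 (D N y))
      (fun N => measurable_const.min (hD N)) (fun N y => abs_min_one_le_one (hD0 N y))
      (fun _ => 0) (fun _ => by simp) (fun η hη => by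
        refine tendsto_of_tendsto_of_tendsto_of_le_of_le tendsto_const_nhds (hL η hη)
          (fun N => zero_le) (fun N => measure_mono fun x hx => ?_)
        simp only [mem_setOf_eq, sub_zero] at hx ⊢
        rw [abs_of_nonneg (le_min zero_le_one (hD0 N x))] at hx
        exact hx.trans_le (min_le_right _ _))
    simpa only [sub_zero] using h
  set δ₁ : ℝ := min δ 2⁻¹
  have hδ₁pos : 0 < δ₁ := lt_min hδ (by norm_num)
  have hδ₁δ : δ₁ ≤ δ := min_le_left _ _
  have hδ₁1 : δ₁ < 1 := (min_le_right _ _).trans_lt (by norm_num)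
  obtain ⟨C, hC, hCN⟩ := h2 (δ₁ / 2) (by positivity)
  have hev : ∀ᶠ N : ℕ in atTop, (∫ y, min 1 (D N y) ∂μ N) ≤ δ₁ / 2 :=
    hm.eventually (ge_mem_nhds (by positivity))
  obtain ⟨N₀, hN₀⟩ := eventually_atTop.1 hev
  -- the constant
  set C' : ℝ := max C (max (N₀ : ℝ) 3)
  have hCC' : C ≤ C' := le_max_left _ _
  have hC'3 : (3 : ℝ) ≤ C' := (le_max_right _ _).trans (le_max_right _ _)
  have hC'N₀ : (N₀ : ℝ) ≤ C' := (le_max_left _ _).trans (le_max_right _ _)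
  have hC'pos : 0 < C' := hC.trans_le hCC'
  refine ⟨C', hC'pos, fun N => ?_⟩
  haveI := hμ N
  by_cases hN : N₀ ≤ N
  · -- large `N`: the event is inside `{δ₁/2 < |min 1 D − ∫ min 1 D|}`
    have hsub : {x | δ < D N x} ⊆
        {x | δ₁ / 2 < |min 1 (D N x) - ∫ y, min 1 (D N y) ∂μ N|} := by
      intro x hx
      simp only [mem_setOf_eq] at hx ⊢
      have hmN := hN₀ N hN
      have hG : δ₁ < min 1 (D N x) := lt_min hδ₁1 (hδ₁δ.trans_lt hx)
      exact lt_of_lt_of_le (by linarith) (le_abs_self _)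
    calc μ N {x | δ < D N x}
        ≤ μ N {x | δ₁ / 2 < |min 1 (D N x) - ∫ y, min 1 (D N y) ∂μ N|} := measure_mono hsub
      _ ≤ ENNReal.ofReal (C * Real.exp (-(C⁻¹ * ((N : ℝ) + 1)))) := hCN N
      _ ≤ ENNReal.ofReal (C' * Real.exp (-(C'⁻¹ * ((N : ℝ) + 1)))) :=
          ENNReal.ofReal_le_ofReal (UniformLGC.Kexp_le_Kexp hC hCC' (by positivity))
  · -- small `N`: the bound is at least `1`
    have hN' : (N : ℝ) + 1 ≤ N₀ := by exact_mod_cast Nat.lt_of_not_le hN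
    have hexp : Real.exp (-1) ≤ Real.exp (-(C'⁻¹ * ((N : ℝ) + 1))) := by
      refine Real.exp_le_exp.2 ?_
      have h1 : C'⁻¹ * ((N : ℝ) + 1) ≤ C'⁻¹ * C' :=
        mul_le_mul_of_nonneg_left (hN'.trans hC'N₀) (inv_nonneg.2 hC'pos.le)
      rw [inv_mul_cancel₀ hC'pos.ne'] at h1
      linarith
    have he : (1 : ℝ) ≤ 3 * Real.exp (-1) := by
      have := Real.exp_one_lt_d9
      have h1 : Real.exp (-1) = (Real.exp 1)⁻¹ := Real.exp_neg 1
      rw [h1, ← div_eq_mul_inv, le_div_iff₀ (Real.exp_pos 1)]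
      linarith
    have hone : (1 : ℝ) ≤ C' * Real.exp (-(C'⁻¹ * ((N : ℝ) + 1))) := by
      calc (1 : ℝ) ≤ 3 * Real.exp (-1) := he
        _ ≤ C' * Real.exp (-(C'⁻¹ * ((N : ℝ) + 1))) :=
            mul_le_mul hC'3 hexp (Real.exp_pos _).le hC'pos.le
    calc μ N {x | δ < D N x} ≤ 1 := prob_le_one
      _ ≤ ENNReal.ofReal (C' * Real.exp (-(C'⁻¹ * ((N : ℝ) + 1)))) :=
          ENNReal.one_le_ofReal.2 hone

/-! ### G1: `LambertianEuler ∧ S2 ⟹ LD` -/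

/-- **LambertianEuler ∧ S2 ⟹ exponential-rate Euler for `Λ`**: for the density field take the fixed 1-Lipschitz
`[0, 1]`-valued statistic `F(d, m, e) := min 1 |d − ∫ χ ρ_t|` (the Euler value does not depend on `N`);
LambertianEuler gives `m_N := ∫ F(fld(Λ_t)) d(P_N ⊗ γ^ℕ) → 0` (bounded convergence in probability on probability spaces), so for
`N ≥ N₀` one has `m_N ≤ δ₁/2` with `δ₁ := min δ 2⁻¹` and `{δ < |d − ∫χρ_t|} ⊆ {δ₁/2 < |F − m_N|}`; S2 at `(F, δ₁/2)` bounds the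
latter by `C e^{−(N+1)/C}` for all `N`, and the finitely many `N < N₀` are absorbed by enlarging the constant
(`UniformLGC.Kexp_le_Kexp`, cf. `expConc_sub_integral_of_expConc_sub_const`); likewise momentum (`F := min 1 ‖m − ∫χρ_t u_t‖`)
and energy; `σ₀ := min (1/2) (min σ_L σ₂)`. [folklore] -/
theorem stub_LD_of_euler_of_fieldConcentration
    (hL :
  ∀ (a₀ θ₀ : T3 → ℝ) (u₀ : T3 → V3), Continuous a₀ → Continuous θ₀ → Continuous u₀ →
    (∀ x, 0 < a₀ x) → (∀ x, 0 < θ₀ x) →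
    ∃ σ₀ : ℝ, 0 < σ₀ ∧ ∀ σ : ℝ, 0 < σ → σ < σ₀ →
      ∀ (T : ℝ) (ρ θ : ℝ → T3 → ℝ) (u : ℝ → T3 → V3), IsHardSphereEulerSolution σ T ρ u θ →
        ∀ Φ : (N : ℕ) → HardSphereFlow (Torus.geometry (Fin 3)) (hsDiameter σ N) (N + 1),
          TendstoHydroFieldsAt (fun N => localGibbsLaw σ a₀ u₀ θ₀ N (Φ N)) Φ ρ u θ 0 →
            ∀ t ∈ Set.Ico 0 T, ∀ χ : T3 → ℝ, Continuous χ → ∀ δ > (0 : ℝ),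
              Tendsto (fun N : ℕ => ((localGibbsLaw σ a₀ u₀ θ₀ N (Φ N)).prod (lambertNoise (Fin 3)))
                {p | δ < |empiricalDensityField
                  (lambertFlow (Torus.geometry (Fin 3)) (hsDiameter σ N) p.2 p.1 t) χ -
                    ∫ x, χ x * ρ t x|}) atTop (nhds 0) ∧
              Tendsto (fun N : ℕ => ((localGibbsLaw σ a₀ u₀ θ₀ N (Φ N)).prod (lambertNoise (Fin 3)))
                {p | δ < ‖empiricalMomentumField
                  (lambertFlow (Torus.geometry (Fin 3)) (hsDiameter σ N) p.2 p.1 t) χ -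
                    ∫ x, (χ x * ρ t x) • u t x‖}) atTop (nhds 0) ∧
              Tendsto (fun N : ℕ => ((localGibbsLaw σ a₀ u₀ θ₀ N (Φ N)).prod (lambertNoise (Fin 3)))
                {p | δ < |empiricalEnergyField
                  (lambertFlow (Torus.geometry (Fin 3)) (hsDiameter σ N) p.2 p.1 t) χ -
                    ∫ x, χ x * totalEnergyDensity (ρ t x) (u t x) (θ t x)|}) atTop (nhds 0)) 
    (h2 :
    ∀ (a₀ θ₀ : T3 → ℝ) (u₀ : T3 → V3), Continuous a₀ → Continuous θ₀ → Continuous u₀ →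
      (∀ x, 0 < a₀ x) → (∀ x, 0 < θ₀ x) →
      ∃ σ₀ : ℝ, 0 < σ₀ ∧ ∀ σ : ℝ, 0 < σ → σ < σ₀ →
        ∀ (T : ℝ) (ρ θ : ℝ → T3 → ℝ) (u : ℝ → T3 → V3), IsHardSphereEulerSolution σ T ρ u θ →
          ∀ Φ : (N : ℕ) → HardSphereFlow (Torus.geometry (Fin 3)) (hsDiameter σ N) (N + 1),
            TendstoHydroFieldsAt (fun N => localGibbsLaw σ a₀ u₀ θ₀ N (Φ N)) Φ ρ u θ 0 →
              ∀ t ∈ Set.Ico 0 T, ∀ χ : T3 → ℝ, Continuous χ →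
                ∀ F : ℝ × V3 × ℝ → ℝ, LipschitzWith 1 F → (∀ y, |F y| ≤ 1) → ∀ δ : ℝ, 0 < δ →
                  ∃ C : ℝ, 0 < C ∧ ∀ N : ℕ,
                    ((localGibbsLaw σ a₀ u₀ θ₀ N (Φ N)).prod (lambertNoise (Fin 3)))
                      {p | δ < |F (empiricalDensityField
                              (lambertFlow (Torus.geometry (Fin 3)) (hsDiameter σ N) p.2 p.1 t) χ,
                            empiricalMomentumField
                              (lambertFlow (Torus.geometry (Fin 3)) (hsDiameter σ N) p.2 p.1 t) χ,
                            empiricalEnergyField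
                              (lambertFlow (Torus.geometry (Fin 3)) (hsDiameter σ N) p.2 p.1 t) χ) -
                          ∫ q, F (empiricalDensityField
                              (lambertFlow (Torus.geometry (Fin 3)) (hsDiameter σ N) q.2 q.1 t) χ,
                            empiricalMomentumField
                              (lambertFlow (Torus.geometry (Fin 3)) (hsDiameter σ N) q.2 q.1 t) χ,
                            empiricalEnergyField
                              (lambertFlow (Torus.geometry (Fin 3)) (hsDiameter σ N) q.2 q.1 t) χ)
                            ∂((localGibbsLaw σ a₀ u₀ θ₀ N (Φ N)).prod (lambertNoise (Fin 3)))|} ≤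
                      ENNReal.ofReal (C * Real.exp (-(C⁻¹ * ((N : ℝ) + 1))))) :
    ∀ (a₀ θ₀ : T3 → ℝ) (u₀ : T3 → V3), Continuous a₀ → Continuous θ₀ → Continuous u₀ →
      (∀ x, 0 < a₀ x) → (∀ x, 0 < θ₀ x) →
      ∃ σ₀ : ℝ, 0 < σ₀ ∧ ∀ σ : ℝ, 0 < σ → σ < σ₀ →
        ∀ (T : ℝ) (ρ θ : ℝ → T3 → ℝ) (u : ℝ → T3 → V3), IsHardSphereEulerSolution σ T ρ u θ →
          ∀ Φ : (N : ℕ) → HardSphereFlow (Torus.geometry (Fin 3)) (hsDiameter σ N) (N + 1),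
            TendstoHydroFieldsAt (fun N => localGibbsLaw σ a₀ u₀ θ₀ N (Φ N)) Φ ρ u θ 0 →
              ∀ t ∈ Set.Ico 0 T, ∀ χ : T3 → ℝ, Continuous χ → ∀ δ : ℝ, 0 < δ →
                ∃ C : ℝ, 0 < C ∧ ∀ N : ℕ,
                  ((localGibbsLaw σ a₀ u₀ θ₀ N (Φ N)).prod (lambertNoise (Fin 3)))
                      {p | δ < |empiricalDensityField
                          (lambertFlow (Torus.geometry (Fin 3)) (hsDiameter σ N) p.2 p.1 t) χ -
                        ∫ x, χ x * ρ t x|} ≤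
                    ENNReal.ofReal (C * Real.exp (-(C⁻¹ * ((N : ℝ) + 1)))) ∧
                  ((localGibbsLaw σ a₀ u₀ θ₀ N (Φ N)).prod (lambertNoise (Fin 3)))
                      {p | δ < ‖empiricalMomentumField
                          (lambertFlow (Torus.geometry (Fin 3)) (hsDiameter σ N) p.2 p.1 t) χ -
                        ∫ x, (χ x * ρ t x) • u t x‖} ≤
                    ENNReal.ofReal (C * Real.exp (-(C⁻¹ * ((N : ℝ) + 1)))) ∧
                  ((localGibbsLaw σ a₀ u₀ θ₀ N (Φ N)).prod (lambertNoise (Fin 3)))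
                      {p | δ < |empiricalEnergyField
                          (lambertFlow (Torus.geometry (Fin 3)) (hsDiameter σ N) p.2 p.1 t) χ -
                        ∫ x, χ x * totalEnergyDensity (ρ t x) (u t x) (θ t x)|} ≤
                    ENNReal.ofReal (C * Real.exp (-(C⁻¹ * ((N : ℝ) + 1)))) := by
  intro a₀ θ₀ u₀ ha hθ hu ha0 hθ0
  obtain ⟨σ₁, hσ₁, h1⟩ := hL a₀ θ₀ u₀ ha hθ hu ha0 hθ0
  obtain ⟨σ₂, hσ₂, h2'⟩ := h2 a₀ θ₀ u₀ ha hθ hu ha0 hθ0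
  refine ⟨min 2⁻¹ (min σ₁ σ₂), lt_min (by norm_num) (lt_min hσ₁ hσ₂), ?_⟩
  intro σ hσ hσlt T ρ θ u hE Φ h0 t ht χ hχ δ hδ
  have hσhalf : σ < 2⁻¹ := hσlt.trans_le (min_le_left _ _)
  have hσ₁' : σ < σ₁ := hσlt.trans_le ((min_le_right _ _).trans (min_le_left _ _))
  have hσ₂' : σ < σ₂ := hσlt.trans_le ((min_le_right _ _).trans (min_le_right _ _))
  have hLt := h1 σ hσ hσ₁' T ρ θ u hE Φ h0 t ht χ hχ
  have h2t := h2' σ hσ hσ₂' T ρ θ u hE Φ h0 t ht χ hχ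
  -- notation
  set Q : (N : ℕ) → Measure (Config (N + 1) (Fin 3) T3 × (ℕ → EuclideanSpace ℝ (Fin 3))) :=
    fun N => (localGibbsLaw σ a₀ u₀ θ₀ N (Φ N)).prod (lambertNoise (Fin 3)) with hQ
  have hQN : ∀ N, IsProbabilityMeasure (Q N) := fun N => by
    haveI := isProbabilityMeasure_localGibbsLaw ha hθ hu ha0 hθ0 (by linarith) N (Φ N)
    rw [hQ]; infer_instance
  set X : (N : ℕ) → Config (N + 1) (Fin 3) T3 × (ℕ → EuclideanSpace ℝ (Fin 3)) → ℝ × V3 × ℝ :=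
    fun N p =>
      (empiricalDensityField (lambertFlow (Torus.geometry (Fin 3)) (hsDiameter σ N) p.2 p.1 t) χ,
      empiricalMomentumField (lambertFlow (Torus.geometry (Fin 3)) (hsDiameter σ N) p.2 p.1 t) χ,
      empiricalEnergyField (lambertFlow (Torus.geometry (Fin 3)) (hsDiameter σ N) p.2 p.1 t) χ)
  have hXm : ∀ N, Measurable (X N) := fun N =>
    (measurable_fieldTriple hχ).comp (measurable_lambertFlow_hsDiameter hσ.le hσhalf N t)
  -- density: `D := |X.1 − ∫ χ ρ_t|`, statistic `min 1 D`
  obtain ⟨C₁, hC₁, hd⟩ := expConc_of_tendsto_measure_of_expConc_min Q hQN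
    (fun N p => |(X N p).1 - ∫ x, χ x * ρ t x|)
    (fun N => ((hXm N).fst.sub measurable_const).abs) (fun N p => abs_nonneg _)
    (fun η hη => (hLt η hη).1)
    (fun δ' hδ' => h2t _ (lipschitzWith_min_one_abs_fst_sub (∫ x, χ x * ρ t x))
      (fun y => abs_min_one_le_one (abs_nonneg _)) δ' hδ') hδ
  -- momentum: `D := ‖X.2.1 − ∫ χ ρ_t u_t‖`
  obtain ⟨C₂, hC₂, hmo⟩ := expConc_of_tendsto_measure_of_expConc_min Q hQN
    (fun N p => ‖(X N p).2.1 - ∫ x, (χ x * ρ t x) • u t x‖)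
    (fun N => ((hXm N).snd.fst.sub measurable_const).norm) (fun N p => norm_nonneg _)
    (fun η hη => (hLt η hη).2.1)
    (fun δ' hδ' => h2t _ (lipschitzWith_min_one_norm_snd_fst_sub (∫ x, (χ x * ρ t x) • u t x))
      (fun y => abs_min_one_le_one (norm_nonneg _)) δ' hδ') hδ
  -- energy: `D := |X.2.2 − ∫ χ E_t|`
  obtain ⟨C₃, hC₃, hen⟩ := expConc_of_tendsto_measure_of_expConc_min Q hQN
    (fun N p => |(X N p).2.2 - ∫ x, χ x * totalEnergyDensity (ρ t x) (u t x) (θ t x)|)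
    (fun N => ((hXm N).snd.snd.sub measurable_const).abs) (fun N p => abs_nonneg _)
    (fun η hη => (hLt η hη).2.2)
    (fun δ' hδ' => h2t _
      (lipschitzWith_min_one_abs_snd_snd_sub
        (∫ x, χ x * totalEnergyDensity (ρ t x) (u t x) (θ t x)))
      (fun y => abs_min_one_le_one (abs_nonneg _)) δ' hδ') hδ
  -- one constant for the three fields
  refine ⟨max C₁ (max C₂ C₃), lt_max_of_lt_left hC₁, fun N => ⟨?_, ?_, ?_⟩⟩
  · exact (hd N).trans (ENNReal.ofReal_le_ofReal
      (UniformLGC.Kexp_le_Kexp hC₁ (le_max_left _ _) (by positivity)))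
  · exact (hmo N).trans (ENNReal.ofReal_le_ofReal
      (UniformLGC.Kexp_le_Kexp hC₂ ((le_max_left _ _).trans (le_max_right _ _)) (by positivity)))
  · exact (hen N).trans (ENNReal.ofReal_le_ofReal
      (UniformLGC.Kexp_le_Kexp hC₃ ((le_max_right _ _).trans (le_max_right _ _)) (by positivity)))

end Summit.AtomisticToContinuum.HydrodynamicLimit.Theorems
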